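import Summits.KontsevichZagierPeriods.KontsevichZagierPeriods.Theses.FurushoPentagon
import Literature.NumberTheory.Transcendental.KZProduct
import Literature.NumberTheory.Transcendental.AyoubPeriodSeries
import Literature.NumberTheory.Transcendental.MZVSimplexRepProofs

/-!
# Crux `KernelModuloPeriodConjecture` (stmt-KontsevichZagierPeriods-15058) — crux-ideate round 1,
# ideator 2: sketch for the idea card `brown-ayoub-compiler`

Everything here is kernel-checked (no `sorry`); prose only in docstrings.

The crux is `MzvPeriodConjecture → PentagonInKZ → ReducedPeriodRing → SectorToKernel`
(route FurushoPentagon, rev 20). Its content splits (route header, prepared glued split) into the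
MZV-SECTOR kernel form and the off-sector complement. This sketch types

* `MzvSectorKernel` / `OffMzvSectorComplement` and the trivial glue
  `kernelModuloPeriodConjecture_of : (MzvPeriodConjecture → MzvSectorKernel) →
   OffMzvSectorComplement → KernelModuloPeriodConjecture` (concludes the crux BY NAME);
* the rules-level Hoffman spanning statements `HoffmanSpanInKZ` (effective) and
  `HoffmanSpanPiLocal` ([π]-local) with `hoffmanSpanInKZ_of_piLocal` (uses `KZ.PiCancellation`);
* the hypothesis bundle `CompilerModel` = the OUTPUT INTERFACE of the card's lever (Brown's real
  geometric motivic periods of `MT(ℤ)` with the Hoffman basis, the Goncharov–Manin lifts, and the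
  Ayoub-cube certificate with its transfer into `KZ.relations`), and the PROVED theorems
  `CompilerModel.per_injective` (MzvPeriodConjecture ⇒ the period map is injective) and
  `mzvSectorKernel_of` (a compiler model + MzvPeriodConjecture ⇒ `MzvSectorKernel`);
* the concrete shape of the certificate over the tree's Ayoub vocabulary
  (`AyoubRel.Oan`, `AyoubRel.relAC`, `AyoubRel.kSpan`): `cubeStokesSpan`, `GMCubeData.Cert`.

References: F. Brown, Ann. of Math. 175 (2012) Thm 1.1/7.4, (7.2) (arXiv:1102.1312); F. Brown,
ICM 2014, arXiv:1407.5165 §1.3.1, Thm 1.5 (`𝓗 = 𝒫^{𝔪,+}_{MT(ℤ),ℝ}`); A. Goncharov, Yu. Manin,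
Compos. Math. 140 (2004) (arXiv:math/0204102) Thm 1.? / Cor. 3.2; J. Ayoub, Ann. of Math. 181
(2015) Thm 3.13 + Lemme 3.12 + §3.5 torsor statement (= Crelle 2014 II Prop. 2.108, Thm 2.93);
J. Ayoub, EMS Newsl. 91 (2014) Def. 10, Prop. 11, Rem. 12–13.
-/

noncomputable section

set_option linter.dupNamespace false

namespace Summit.KontsevichZagierPeriods.KontsevichZagierPeriods.Cruxes.KernelModuloPeriodConjecture.BrownAyoubCompiler

open Literature.NumberTheory.Transcendental
open Literature.NumberTheory.Transcendental.KZ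
open Summit.KontsevichZagierPeriods.KontsevichZagierPeriods.Theses.FurushoPentagon

/-! ## §0 The MZV sector of the rules ring -/

/-- Admissible indices. [Zagier 1994, §1] -/
abbrev AdmIdx : Type := {s : List ℕ // MZV.IsAdmissible s}

/-- Hoffman indices (entries in `{2,3}`). [Hoffman 1997; Brown 2012, Thm 1.1] -/
abbrev HoffIdx : Type := {s : List ℕ // MZV.IsHoffman s}

/-- The simplex class `[Δ_s, ∏ ω_{εᵢ}]` of `ζ(s)` in `KZ.FormalRep` (Kontsevich's formula).
[Kontsevich–Zagier 2001, §1.1] -/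
def zetaRep (s : AdmIdx) : FormalRep :=
  of (mzvRep s.1 s.2 (mzvIntegrand_isSemialgebraicFunOn_holds s.1)
    (mzvIntegrand_integrableOn_holds s.1 s.2))

/-- `eval [Δ_s, ∏ ω] = ζ(s)` (tree theorem `KZ.mzvRep_value_holds`). [Zagier 1994, §9] -/
theorem eval_zetaRep (s : AdmIdx) : eval (zetaRep s) = multipleZeta s.1 := by
  unfold zetaRep
  rw [eval_of]
  exact mzvRep_value_holds _ _ _ _

/-- The MZV sector: the subgroup of `KZ.FormalRep` generated by the simplex classes of all
admissible indices (the empty index gives the unit `[pt, 1]`). [Kontsevich–Zagier 2001, §1.1] -/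
def mzvSector : AddSubgroup FormalRep := AddSubgroup.closure (Set.range zetaRep)

/-- Conjecture 1 in kernel form ON THE MZV SECTOR (the route header's typed target
`MzvSectorKernel`). [Kontsevich–Zagier 2001, §1.2 Conjecture 1] -/
def MzvSectorKernel : Prop := ∀ c ∈ mzvSector, eval c = 0 → c ∈ relations

/-- The off-sector complement (second child of the route's prepared split; NOT CLAIMED):
the sector kernel form implies the full kernel form. [Kontsevich–Zagier 2001, §1.2] -/
def OffMzvSectorComplement : Prop :=
  MzvSectorKernel → ∀ c : FormalRep, eval c = 0 → c ∈ relations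

/-- **Glue to the crux, by name.** `(MzvPeriodConjecture → MzvSectorKernel)` and the off-sector
complement give `KernelModuloPeriodConjecture` (the antecedents `PentagonInKZ`,
`ReducedPeriodRing` and the inner `StuffleInKZ`, `HoffmanRelationInKZ` are not used: on the sector
the card's lever replaces them, cf. the parent crux's `Disproof.lean` §4). [folklore] -/
theorem kernelModuloPeriodConjecture_of
    (hsec : MzvPeriodConjecture → MzvSectorKernel) (hoff : OffMzvSectorComplement) :
    KernelModuloPeriodConjecture := by
  intro hZ _hP _hR _hS _hH c hc
  exact hoff (hsec hZ) c hc

/-! ## §1 Rules-level Hoffman spanning: effective and `[π]`-local forms -/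

/-- **HoffmanSpanInKZ** (rules level; = route CoactionDevissage's crux `HoffmanSpan` up to
conventions): for every admissible `s` there are `D > 0` and an integer combination of Hoffman
simplex classes of the same weight with `D • [ζ(s)] − Σ b_t • [ζ(t)] ∈ KZ.relations`.
The card claims this is reachable WITHOUT transcendence and WITHOUT Grothendieck–Teichmüller
input (Brown + Goncharov–Manin + Ayoub's presentation theorem + rules-side stubs).
[Brown 2012, Cor. 7.5 (motivic Hoffman spanning); Ayoub 2015, Thm 3.13] -/
def HoffmanSpanInKZ : Prop :=
  ∀ s : AdmIdx, ∃ (D : ℕ) (b : HoffIdx →₀ ℤ), 0 < D ∧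
    (∀ t ∈ b.support, MZV.weight t.1 = MZV.weight s.1) ∧
    D • zetaRep s - b.sum (fun t n => n • zetaRep ⟨t.1, t.2.isAdmissible⟩) ∈ relations

/-- Multiplication by the disc class `[π]`. [Kontsevich–Zagier 2001, §4.1] -/
def piMul (x : FormalRep) : FormalRep := of piRep * x

/-- **HoffmanSpanPiLocal**: the same statement after multiplication by a power of `[π]` — what the
LOCALISED form of Ayoub's theorem (EMS Newsl. Prop. 11; Ann. 2015 Lemme 3.12) delivers without
the density lemma of the card. [Ayoub 2014, Prop. 11] -/
def HoffmanSpanPiLocal : Prop :=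
  ∀ s : AdmIdx, ∃ (N D : ℕ) (b : HoffIdx →₀ ℤ), 0 < D ∧
    (∀ t ∈ b.support, MZV.weight t.1 = MZV.weight s.1) ∧
    piMul^[N] (D • zetaRep s - b.sum (fun t n => n • zetaRep ⟨t.1, t.2.isAdmissible⟩)) ∈ relations

/-- `[π]`-cancellation iterates. [folklore] -/
theorem mem_relations_of_iterate_piMul (hπ : PiCancellation) :
    ∀ (N : ℕ) (c : FormalRep), piMul^[N] c ∈ relations → c ∈ relations := by
  intro N
  induction N with
  | zero => intro c hc; simpa using hc
  | succ n ih =>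
    intro c hc
    rw [Function.iterate_succ_apply] at hc
    exact hπ c (ih _ hc)

/-- `HoffmanSpanPiLocal ∧ PiCancellation ⇒ HoffmanSpanInKZ` (the fallback assembly through route
AyoubSpecialisation's item 0540). [folklore] -/
theorem hoffmanSpanInKZ_of_piLocal (h : HoffmanSpanPiLocal) (hπ : PiCancellation) :
    HoffmanSpanInKZ := by
  intro s
  obtain ⟨N, D, b, hD, hw, hmem⟩ := h s
  exact ⟨D, b, hD, hw, mem_relations_of_iterate_piMul hπ N _ hmem⟩

/-! ## §2 The compiler interface and the sector kernel -/

/-- **The output interface of the lever** (hypothesis bundle, D-0026 style; every field is a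
statement in print or a stub of the line):
* `V, per` — Brown's real geometric motivic periods `𝒫^{𝔪,+}_{MT(ℤ),ℝ}` with the period map
  (Brown ICM 2014 §1.3.1);
* `hoff, per_hoff, span_hoff` — the motivic Hoffman elements `ζ^𝔪(t)` span `V` and have periods
  `ζ(t)` (Brown 2012 Thm 1.1 / 7.4 + (7.2); ICM 2014 Thm 1.5: `𝓗 = 𝒫^{𝔪,+}_{MT(ℤ),ℝ}`);
* `g, per_g` — the Goncharov–Manin framed motives `[H^n(M̄_{0,n+3}∖A_s, B∖B∩A_s), Ω_s, X̄_δ]^𝔪 ∈ V`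
  with period `ζ(s)` (GM 2004, main theorem + Cor. 3.2: `Ω_s` is regular on a neighbourhood of the
  compact cell `X̄_δ` — a TAME cube datum after cubulating the associahedron);
* `Cert, compile` — THE LEVER: a vanishing `ℤ`-combination of the `g s` in `V ⊆ 𝒫^𝔪_{MT(ℤ)}`
  maps, by functoriality of matrix coefficients along `MT(ℤ) ⊂ DM_gm(ℚ)` and the density lemma
  (effective mixed Tate periods inject: `𝒜 ⊗ ℚ[𝕃] ↪ 𝒜 ⊗ ℚ[𝕃^±]`), to `0` in Ayoub's effective
  formal period ring `P^{eff}(ℚ) = H⁰ Bti(Ω^•) ≅ 𝒪_{ℚ-alg}(𝔻̄^∞) / ⟨∂ᵢG − G|_{zᵢ=1} + G|_{zᵢ=0}⟩`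
  (Ayoub 2015 Thm 3.13), i.e. the GM cube data of the combination lie in the Stokes span
  (`GMCubeData.Cert` below is the concrete shape);
* `transfer` — the rules-side stubs: each Stokes element is two moves (route FurushoPentagon's
  crux-10813 line effective-cube-surjection, stubs S5 `stub_stokesSpanCalibration` + S4), and the
  GM cube data of `s` are move-equivalent to `[Δ_s, ∏ ω]` (MzvTameCubulation: GM chart = rule 2,
  cubulation + dyadic halving = rules 1a + 2).
[cite: Brown2012, Thm 1.1; arXiv:1407.5165 §1.3.1, Thm 1.5; arXiv:math/0204102 Cor. 3.2;
Ayoub2015, Thm 3.13] -/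
structure CompilerModel where
  /-- `𝒫^{𝔪,+}_{MT(ℤ),ℝ}`. -/
  V : Type
  [instAddCommGroup : AddCommGroup V]
  [instModule : Module ℚ V]
  /-- The period map. -/
  per : V →ₗ[ℚ] ℝ
  /-- Brown's motivic Hoffman elements. -/
  hoff : HoffIdx → V
  /-- `per ζ^𝔪(t) = ζ(t)`. -/
  per_hoff : ∀ t, per (hoff t) = multipleZeta t.1
  /-- Brown: the Hoffman elements span `𝒫^{𝔪,+}_{MT(ℤ),ℝ}`. -/
  span_hoff : ⊤ ≤ Submodule.span ℚ (Set.range hoff)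
  /-- The Goncharov–Manin framed lifts. -/
  g : AdmIdx → V
  /-- `per g(s) = ζ(s)`. -/
  per_g : ∀ s, per (g s) = multipleZeta s.1
  /-- "the GM cube data of the combination `c` lie in Ayoub's Stokes span". -/
  Cert : (AdmIdx →₀ ℤ) → Prop
  /-- THE LEVER: vanishing in `𝒫^𝔪_{MT(ℤ)}` compiles to a cube-Stokes certificate. -/
  compile : ∀ c : AdmIdx →₀ ℤ, (c.sum fun s n => n • g s) = 0 → Cert c
  /-- Rules side: a certificate is a move chain for the simplex classes. -/
  transfer : ∀ c : AdmIdx →₀ ℤ, Cert c → (c.sum fun s n => n • zetaRep s) ∈ relations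

attribute [instance] CompilerModel.instAddCommGroup CompilerModel.instModule

namespace CompilerModel

variable (M : CompilerModel)

/-- **MzvPeriodConjecture ⇒ the period map is injective on `𝒫^{𝔪,+}_{MT(ℤ),ℝ}`**: a spanning
family whose periods are `ℚ`-linearly independent is a basis mapped to an independent family.
[Brown 2012, Thm 1.1; folklore] -/
theorem per_injective (hZ : MzvPeriodConjecture) : Function.Injective M.per := by
  refine (injective_iff_map_eq_zero M.per).2 fun v hv => ?_
  have hvspan : v ∈ Submodule.span ℚ (Set.range M.hoff) :=
    M.span_hoff (Submodule.mem_top : v ∈ (⊤ : Submodule ℚ M.V))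
  obtain ⟨c, rfl⟩ := (Finsupp.mem_span_range_iff_exists_finsupp).1 hvspan
  have hper : M.per (c.sum fun i a => a • M.hoff i) =
      Finsupp.linearCombination ℚ (fun u : HoffIdx => multipleZeta u.1) c := by
    rw [Finsupp.linearCombination_apply, map_finsuppSum]
    exact Finsupp.sum_congr fun t _ => by rw [map_smul, M.per_hoff]
  rw [hper] at hv
  have hc : c = 0 := (linearIndependent_iff.1 hZ) c hv
  simp [hc]

/-- Periods of an integer combination of GM lifts. [folklore] -/
theorem per_sum_g (n : AdmIdx →₀ ℤ) :
    M.per (n.sum fun s k => k • M.g s) = n.sum fun s k => k • multipleZeta s.1 := by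
  rw [map_finsuppSum]
  exact Finsupp.sum_congr fun s _ => by rw [map_zsmul, M.per_g]

end CompilerModel

/-- Values of an integer combination of simplex classes. [folklore] -/
theorem eval_sum_zetaRep (n : AdmIdx →₀ ℤ) :
    eval (n.sum fun s k => k • zetaRep s) = n.sum fun s k => k • multipleZeta s.1 := by
  rw [map_finsuppSum]
  exact Finsupp.sum_congr fun s _ => by rw [map_zsmul, eval_zetaRep]

/-- Every element of the MZV sector is a finitely supported `ℤ`-combination of simplex classes.
[folklore] -/
theorem exists_finsupp_of_mem_mzvSector {c : FormalRep} (hc : c ∈ mzvSector) :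
    ∃ n : AdmIdx →₀ ℤ, (n.sum fun s k => k • zetaRep s) = c := by
  have hc' : c ∈ Submodule.span ℤ (Set.range zetaRep) := by
    rw [← Submodule.mem_toAddSubgroup, Submodule.span_int_eq_addSubgroupClosure]
    exact hc
  exact (Finsupp.mem_span_range_iff_exists_finsupp).1 hc'

/-- **A compiler model plus MzvPeriodConjecture gives Conjecture 1 on the MZV sector.**
`eval c = 0` ⇒ `per (Σ n_s g_s) = 0` ⇒ (injectivity) `Σ n_s g_s = 0` in `𝒫^𝔪` ⇒ (compile) a
cube-Stokes certificate ⇒ (transfer) `c ∈ KZ.relations`. No pentagon, no reducedness, no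
Grothendieck–Teichmüller statement, no `[π]`-cancellation.
[Brown 2012, Thm 1.1; Ayoub 2015, Thm 3.13; Kontsevich–Zagier 2001, §1.2] -/
theorem mzvSectorKernel_of (M : CompilerModel) (hZ : MzvPeriodConjecture) : MzvSectorKernel := by
  intro c hc hev
  obtain ⟨n, rfl⟩ := exists_finsupp_of_mem_mzvSector hc
  have hzero : (n.sum fun s k => k • M.g s) = 0 := by
    apply M.per_injective hZ
    rw [M.per_sum_g, ← eval_sum_zetaRep, hev, map_zero]
  exact M.transfer n (M.compile n hzero)

/-- **The crux from the compiler model, the named transcendence input and the off-sector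
complement** (the card's assembly, by name). [folklore] -/
theorem kernelModuloPeriodConjecture_of_compilerModel (M : CompilerModel)
    (hoff : OffMzvSectorComplement) : KernelModuloPeriodConjecture :=
  kernelModuloPeriodConjecture_of (fun hZ => mzvSectorKernel_of M hZ) hoff

/-! ## §3 The concrete shape of the certificate (Ayoub's effective cube ring over `ℚ`) -/

/-- The Stokes span of Ayoub's effective presentation over `k = ℚ`: finite `ℚ`-combinations of
`∂ᵢG − G|_{zᵢ=1} + G|_{zᵢ=0}`, `G ∈ 𝒪_{ℚ-alg}(𝔻̄^∞)`. By Ayoub 2015 Thm 3.13 it is EXACTLY the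
kernel of `𝒪_{ℚ-alg}(𝔻̄^∞) → P^{eff}(ℚ, σ) = H⁰ Bti(Ω^•_{/ℚ})`, the ring of effective formal
periods of Voevodsky motives. [Ayoub 2015, Thm 3.13; Ayoub 2014, Def. 10] -/
def cubeStokesSpan : Set AyoubRel.CSeries :=
  AyoubRel.kSpan (Rat.castHom ℂ)
    {x | ∃ G ∈ AyoubRel.Oan (Rat.castHom ℂ), ∃ i : ℕ, x = AyoubRel.relAC i G}

/-- Tame cube data for the admissible indices: for each `s` a finite family of Ayoub generators
(intended: the Goncharov–Manin form `Ω_s` pulled back along a Nash cubulation of the compact cell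
`X̄_δ ⊂ M̄^δ_{0,n+3}(ℝ)`, dyadically halved until the complex polyradius exceeds `1`).
[Goncharov–Manin 2004, Cor. 3.2; Ayoub 2014, Def. 9 and Rem. 12] -/
structure GMCubeData where
  /-- the finite family of cube integrands representing `ζ(s)` -/
  F : AdmIdx → List AyoubRel.CSeries
  /-- each is an Ayoub generator over `ℚ` -/
  mem_Oan : ∀ s, ∀ x ∈ F s, x ∈ AyoubRel.Oan (Rat.castHom ℂ)

/-- The total cube integrand of an integer combination. [folklore] -/
def GMCubeData.total (Φ : GMCubeData) (c : AdmIdx →₀ ℤ) : AyoubRel.CSeries :=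
  c.sum fun s n => n • (Φ.F s).sum

/-- The certificate predicate the `CompilerModel` is meant to be instantiated with: the total cube
integrand of `c` lies in the Stokes span. [Ayoub 2015, Thm 3.13] -/
def GMCubeData.Cert (Φ : GMCubeData) (c : AdmIdx →₀ ℤ) : Prop := Φ.total c ∈ cubeStokesSpan

end Summit.KontsevichZagierPeriods.KontsevichZagierPeriods.Cruxes.KernelModuloPeriodConjecture.BrownAyoubCompiler
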